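import Mathlib
import Summits.PneNP.PneNP.Theorems.ClusUniversalCertificateCoordSlice
import Summits.PneNP.PneNP.Theorems.ClusUniversalCertificateCoordInv
import Summits.PneNP.PneNP.Theorems.ClusUniversalCertificateCoordBook
import Summits.PneNP.PneNP.Theorems.ClusUniversalCertificateCoordBookBlk
import Summits.PneNP.PneNP.Theorems.ClusUniversalCertificateCoordBaseTwoBlocks
import Summits.PneNP.PneNP.Theorems.ClusUniversalCertificateCoordBaseOnes
import Summits.PneNP.PneNP.Theorems.ClusUniversalCertificateCoordSliceZeroFree

/-!
# Route ClusUniversalCertificate, crux `UniversalCertAll` — line `slicing`: registered stub `stub_reduce`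

Proof (planner pnp-ideate-p1 g19) of the registered stub `stub_reduce` of skeleton
`Cruxes/UniversalCertAll/Lines/slicing.lean` (sha16 965b363e1847, stmt-PneNP-19683): the mixed certificate in every total dimension follows from
the CORE STEP, by the strong induction of `ClusCoord.ucMixDim_all_peel` run with the landed theorems.  FRONTIER rung F-N1; the conjecture
`stub_core` and the crux are OPEN; nothing here bears on P vs NP.
-/

set_option linter.dupNamespace false -- `Summit.PneNP.PneNP.…`: summit = sub-problem name (D-0017 single-conjunct layout)

namespace Summit.PneNP.PneNP.Theorems.ClusCoord

open Finset

/-- **Registered stub `stub_reduce`** of line `slicing` (skeleton sha16 965b363e1847, stmt-PneNP-19683), BY NAME: the mixed certificate in every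
total dimension follows from the CORE STEP (the mixed certificate on the zero-rare hard core — `GZeroRare`, at least three nonempty blocks, a block of
size `≥ 2`, a zero in every nonempty block — given the certificate in all smaller total dimensions).  [strong induction on `M` with the landed
`ucMixDim_zero`, `stub_slice`, `stub_cBook`, `stub_inv`, `stub_baseTwoBlocks`, `stub_baseOnes`, `stub_sliceZeroFreeBlock`, `stub_cBookBlk`] -/
theorem stub_reduce :
    (∀ M : ℕ, (∀ M' : ℕ, M' < M → UCMixDim M') →
      ∀ (n : ℕ) (blk : Fin M → Fin n) (Y : Finset (Fin M → ZMod 2)),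
        GZeroRare blk Y → 2 < (univ.filter fun j : Fin n => 0 < bsize blk j).card → (∃ j : Fin n, 1 < bsize blk j) →
        (∀ j : Fin n, 0 < bsize blk j → 0 < zcount blk j Y) → UCMix M n blk Y) →
    ∀ M : ℕ, UCMixDim M := by
  intro hcore M
  induction M using Nat.strong_induction_on with
  | _ M ih =>
    cases M with
    | zero => exact ucMixDim_zero
    | succ M =>
      intro n blk Y
      have ihM : UCMixDim M := ih M (Nat.lt_succ_self M)
      -- the free coordinate step
      have free : ∀ (Y' : Finset (Fin (M + 1) → ZMod 2)) (i : Fin (M + 1)),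
          wcount blk i Y' ≤ zcount blk (blk i) Y' → UCMix (M + 1) n blk Y' := by
        intro Y' i hi
        obtain ⟨hfam, hloss⟩ := stub_slice M Y' i
        refine stub_cBook M n blk Y' i [slice Y' i 0, slice Y' i 1] hfam ?_ (fun S _ => ihM n (blk ∘ Fin.succAbove i) S)
        unfold CLayerIneq
        have hzw : ((wcount blk i Y' : ℕ) : ℤ) ≤ ((zcount blk (blk i) Y' : ℕ) : ℤ) := by exact_mod_cast hi
        have hpow : (0 : ℤ) ≤ (2 : ℤ) ^ (bsize blk (blk i) - 1) := by positivity
        have hnn := mul_nonneg hpow (sub_nonneg.mpr hzw)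
        simp only [List.map_cons, List.map_nil, List.sum_cons, List.sum_nil, add_zero]
        linarith
      by_cases hfree : ∃ g : (Fin (M + 1) → ZMod 2) ≃ₗ[ZMod 2] (Fin (M + 1) → ZMod 2), BZP blk g ∧
          ∃ i : Fin (M + 1), wcount blk i (Y.image fun y => g y) ≤ zcount blk (blk i) (Y.image fun y => g y)
      · obtain ⟨g, hg, i, hi⟩ := hfree
        exact stub_inv (M + 1) n blk Y g hg (free _ i hi)
      have hzr : GZeroRare blk Y := by
        intro g hg i
        by_contra hlt
        exact hfree ⟨g, hg, i, not_lt.mp hlt⟩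
      -- at most two nonempty blocks
      by_cases h2 : (univ.filter fun j : Fin n => 0 < bsize blk j).card ≤ 2
      · exact stub_baseTwoBlocks (M + 1) n blk Y h2
      -- all blocks of size ≤ 1
      by_cases h1 : ∃ j : Fin n, 1 < bsize blk j
      swap
      · push Not at h1
        exact stub_baseOnes (M + 1) n blk Y h1
      -- a nonempty zero-free block peels for free
      by_cases hz : ∀ j : Fin n, 0 < bsize blk j → 0 < zcount blk j Y
      swap
      · push Not at hz
        obtain ⟨k, hk, hzk⟩ := hz
        have hz0 : zcount blk k Y = 0 := Nat.le_zero.mp hzk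
        obtain ⟨L, hfam, hineq⟩ :=
          stub_sliceZeroFreeBlock (M + 1) n blk Y k ((univ.filter fun i => blk i ≠ k).card) rfl hk hz0
        exact stub_cBookBlk (M + 1) _ n blk Y k rfl L hfam hineq
          (fun S _ => ih _ (card_filter_ne_lt blk k hk) n _ S)
      -- the hard core
      exact hcore (M + 1) (fun M' hM' => ih M' hM') n blk Y hzr (not_le.mp h2) h1 hz

end Summit.PneNP.PneNP.Theorems.ClusCoord
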